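import Summits.CriticalPhenomena.PercolationContinuityZ3.Theorems.PercNearOneGluingNoHeavyQuantTLBClosure
import Summits.CriticalPhenomena.PercolationContinuityZ3.Theorems.PercNearOneGluingNoHeavyQuantTwoLayerClosure
import HarnessLib

/-!
# QUANT lane R8: bridge between the two landed spellings of the two-layer-bound family — the lead's `LawDec.TLB u τ M ν` (rate
# explicit, one index, `…QuantTLBClosure`) and arm-2 g38's `LawDec.TwoLayer y T M ν` (floor explicit, two indices, `…QuantTwoLayerClosure`)

builds on p205010 (kernel theorem, internal audit signed; external expert review pending)

Support file (`--supports stmt-CriticalPhenomena-4575`), QUANT lane LEAD seat prim-quant-lead (gen 37); lane ruling V363 (file of record =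
`…QuantTLBClosure` / `…QuantTLBClosureHeavy`; arm-2 proves Theorem A — the heavy node at `q = 1` — against `TwoLayer` and bridges).  Two theorems,
standard axioms, no sorries: for a nonnegative law vanishing above `M` and `y < 1`,
`TLB (y/(1−y)) T M ν ↔ TwoLayer y T M ν` (`twoLayer_of_tlb`: the pair `(i, i′)` is the row `d = i′`, whose right side lives on `h ≥ T − i′ > i`;
`tlb_of_twoLayer`: the row `d` is the pair `(⌈T − d⌉ − 1, d)`).  So arm-2's `TwoLayerConvClosed` and the lead's `TLBGateConvClosed` are the same
(refuted) statement, and a proof of the heavy half in either spelling serves `LawDec.TLBGateConvClosedHeavy`.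

[this work] (this lane).  The gluing rows served [cite: KozmaNitzan2024, Conjecture 3 (p. 15)]; product measure [cite: Grimmett1999, §1.3 p. 10].
-/

noncomputable section
namespace Summit.CriticalPhenomena.PercolationContinuityZ3.Theorems

namespace Quant

open Finset

namespace LawDec

/-- the partial sum up to `d` equals the indicator sum over `{0..M}` when the law vanishes above `M`. [this work] -/
theorem sum_range_succ_eq_sum_ite_le {M d : ℕ} {ν : ℕ → ℝ} (hνM : ∀ h, M < h → ν h = 0) :
    ∑ h ∈ Finset.range (d + 1), ν h = ∑ h ∈ Finset.range (M + 1), (if h ≤ d then ν h else 0) := by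
  rw [← Finset.sum_filter]
  symm
  refine Finset.sum_subset_zero_on_sdiff ?_ ?_ (fun _ _ => rfl)
  · intro h hh
    rw [Finset.mem_filter, Finset.mem_range] at hh
    exact Finset.mem_range.2 (Nat.lt_succ_of_le hh.2)
  · intro h hh
    rw [Finset.mem_sdiff, Finset.mem_range, Finset.mem_filter, Finset.mem_range, not_and] at hh
    have hM : M < h := by
      by_contra hle
      exact hh.2 (Nat.lt_succ_of_le (not_lt.mp hle)) (Nat.lt_succ_iff.mp hh.1)
    exact hνM h hM

/-- **`TLB (y/(1−y)) T M ν → TwoLayer y T M ν`** for a nonnegative law vanishing above `M` (`0 < y < 1`): the pair `(i, i′)` is the row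
`d = i′`, whose right side lives on `h ≥ T − i′ > i`. [this work] -/
theorem twoLayer_of_tlb {y T : ℝ} {M : ℕ} {ν : ℕ → ℝ} (hy1 : y < 1) (hν0 : ∀ h, 0 ≤ ν h)
    (hνM : ∀ h, M < h → ν h = 0) (h : TLB (y / (1 - y)) T M ν) : TwoLayer y T M ν := by
  intro i i' hi'i hsum
  have hd : 2 * ((i' : ℕ) : ℝ) < T := by
    have : ((i' : ℕ) : ℝ) ≤ i := by exact_mod_cast hi'i
    linarith
  have h1 := h i' hd
  have hR : ∑ h ∈ Finset.range (M + 1), (if T - i' ≤ (h : ℝ) then ν h else 0)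
      ≤ ∑ h ∈ Finset.range (M + 1), (if i + 1 ≤ h then ν h else 0) := by
    refine Finset.sum_le_sum fun h _ => ?_
    by_cases hc : T - i' ≤ (h : ℝ)
    · have hih : i + 1 ≤ h := by
        have : (i : ℝ) < h := by linarith
        exact_mod_cast this
      rw [if_pos hc, if_pos hih]
    · rw [if_neg hc]
      split_ifs
      · exact hν0 h
      · exact le_rfl
  have hA : 0 ≤ ∑ h ∈ Finset.range (M + 1), (if h ≤ i' then ν h else 0) :=
    Finset.sum_nonneg fun h _ => by split_ifs; exacts [hν0 h, le_rfl]
  rw [sum_range_succ_eq_sum_ite_le hνM] at h1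
  have h2 : y / (1 - y) * ∑ h ∈ Finset.range (M + 1), (if h ≤ i' then ν h else 0)
      ≤ ∑ h ∈ Finset.range (M + 1), (if i + 1 ≤ h then ν h else 0) := h1.trans hR
  rw [div_mul_eq_mul_div, div_le_iff₀ (by linarith)] at h2
  linarith

/-- **`TwoLayer y T M ν → TLB (y/(1−y)) T M ν`** for a nonnegative law vanishing above `M` (`0 < y < 1`): the row `d` is the pair
`(i, i′) = (⌈T − d⌉ − 1, d)`. [this work] -/
theorem tlb_of_twoLayer {y T : ℝ} {M : ℕ} {ν : ℕ → ℝ} (hy1 : y < 1) (hν0 : ∀ h, 0 ≤ ν h)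
    (hνM : ∀ h, M < h → ν h = 0) (h : TwoLayer y T M ν) : TLB (y / (1 - y)) T M ν := by
  intro d hd
  have hpos : 0 < T - d := by
    have : (0 : ℝ) ≤ d := by positivity
    linarith
  -- i := the largest natural number below T − d
  obtain ⟨i, hi1, hi2⟩ : ∃ i : ℕ, (i : ℝ) < T - d ∧ T - d ≤ (i : ℝ) + 1 := by
    have hc0 : 0 < ⌈T - (d : ℝ)⌉₊ := Nat.ceil_pos.mpr hpos
    refine ⟨⌈T - (d : ℝ)⌉₊ - 1, ?_, ?_⟩
    · have e : (((⌈T - (d : ℝ)⌉₊ - 1 : ℕ)) : ℝ) = (⌈T - (d : ℝ)⌉₊ : ℝ) - 1 := by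
        rw [Nat.cast_sub (by omega), Nat.cast_one]
      rw [e]
      have := Nat.ceil_lt_add_one hpos.le
      linarith
    · have e : (((⌈T - (d : ℝ)⌉₊ - 1 : ℕ)) : ℝ) + 1 = (⌈T - (d : ℝ)⌉₊ : ℝ) := by
        rw [Nat.cast_sub (by omega), Nat.cast_one, sub_add_cancel]
      rw [e]
      exact Nat.le_ceil _
  have hdi : d ≤ i := by
    have : (d : ℝ) < (i : ℝ) + 1 := by linarith
    have : d < i + 1 := by exact_mod_cast this
    omega
  have hsum : (i : ℝ) + d < T := by linarith
  have h1 := h i d hdi hsum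
  have hR : ∑ h ∈ Finset.range (M + 1), (if i + 1 ≤ h then ν h else 0)
      = ∑ h ∈ Finset.range (M + 1), (if T - d ≤ (h : ℝ) then ν h else 0) := by
    refine Finset.sum_congr rfl fun h _ => ?_
    by_cases hc : i + 1 ≤ h
    · have : T - d ≤ (h : ℝ) := by
        have : (i : ℝ) + 1 ≤ h := by exact_mod_cast hc
        linarith
      rw [if_pos hc, if_pos this]
    · have : ¬ (T - d ≤ (h : ℝ)) := by
        intro hc'
        have : (h : ℝ) ≤ i := by exact_mod_cast Nat.lt_succ_iff.mp (not_le.mp hc)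
        linarith
      rw [if_neg hc, if_neg this]
  have hA : 0 ≤ ∑ h ∈ Finset.range (M + 1), (if h ≤ d then ν h else 0) :=
    Finset.sum_nonneg fun h _ => by split_ifs; exacts [hν0 h, le_rfl]
  rw [sum_range_succ_eq_sum_ite_le hνM, ← hR, div_mul_eq_mul_div, div_le_iff₀ (by linarith)]
  linarith

/-- **`TLB (y/(1−y)) T M ν ↔ TwoLayer y T M ν`** (nonnegative law vanishing above `M`, `y < 1`). [this work] -/
theorem tlb_iff_twoLayer {y T : ℝ} {M : ℕ} {ν : ℕ → ℝ} (hy1 : y < 1) (hν0 : ∀ h, 0 ≤ ν h)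
    (hνM : ∀ h, M < h → ν h = 0) : TLB (y / (1 - y)) T M ν ↔ TwoLayer y T M ν :=
  ⟨twoLayer_of_tlb hy1 hν0 hνM, tlb_of_twoLayer hy1 hν0 hνM⟩

end LawDec


end Quant

end Summit.CriticalPhenomena.PercolationContinuityZ3.Theorems
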